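import Literature.MathematicalPhysics.QuantumFieldTheory.Balaban1983to89.B9Thm39OneCubeReadingAtLettersY
import Literature.MathematicalPhysics.QuantumFieldTheory.Balaban1983to89.B9RWSumsDefinitePinsPairM

/-!
# `Balaban1983to89.B9Ineq349SiteFromPinsPairM` — T. Bałaban, *Propagators for lattice gauge theories in a background field*, Commun. Math. Phys. **99**
# (1985) 389–434 [Balaban1985BackgroundPropagators], (3.49) p. 399 ⇐ Thm 3.1 (3.42) p. 397 + Thm 3.2 (3.48) p. 398: ROW 25 OF THE N06 CERTIFICATE
# FROM WHAT THE CERTIFICATE ALREADY HOLDS — row 18's Theorem-3.7 leaf on the `PairM` E-letter at the site pins AND rows 15–16's ONE display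
# `(3.48)⁻¹` on the faithful one-cube letters — so that the two displayed row-25 binders `h31S h32B` of edition 16 are DERIVED, not displayed

[4] = T. Bałaban, *Propagators and renormalization transformations for lattice gauge theories. II*, Commun. Math. Phys. **96** (1984) 223–250
[`Balaban1984PropagatorsII`].

statement-level skeleton of published theorems with citation tags; proofs where landed; nothing here is a claim about the Yang–Mills mass gap

THE PRINT.  p. 399: *«These theorems [3.1, 3.2] imply all the properties of the operator R … For the operator P = I − R we obtain, using again Lemma 2.1,
(3.49)»*; p. 410: *«Theorem 3.7 implies that all the inequalities (3.42)–(3.47) hold for G′»*; p. 413: *«This theorem [3.9] implies Theorem 3.2»*.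

WHY THIS FILE (dag-n06-i gen 15, N06 bundle F4, row 25).  The certificate of record, edition 16 (dag-n06-d
`Summits/…/BalabanUVNodesN06AtOpsYNuOfRecordV6EPairMW`, l. 227 ∕ l. 304), still DISPLAYS row 25's two Thm-3.1∕3.2-type inputs
`h31S : Thm31SiteSchemas … (lettersYOfRecordV4 …)` and `h32B : Thm32BlkSchema … (lettersYOfRecordV4 …)` and closes row 25 by
`stmt349Printed_site_of_blockSchemas 𝔏 h31S h32B` (this seat, gen 6).  Both inputs are CONSEQUENCES of what the same certificate holds:
* ROW 18 proves `t37 : B9.Thm37Printed c35Y geo9Y bg9Y (x ↦ E37YPairM … (𝔬 x) (rd x) (H x) …)` (n06-k∕n06-d `B9RWSumsDefinitePinsPairM`), whose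
  convergence predicate is `ConvAll342`, first conjunct n06-c's `Conv342 (𝔬 x) 1 (H x) C δ U` = the two sup block majorants of `(𝔬 x).Gp U` and
  `(𝔬 x).D U ∘ (𝔬 x).Gp U`, and the walk letters ARE pinned to the coordinate models of the genuine `G′(U)` (`hblkS hblkYS hGpS hDS`) — this seat's
  gen-11 `B9Ineq349SiteFromConv342.majorants_of_thm37Printed` ⟹ `thm31LeftSchema_of_majorants` ⟹ (gen 6 `B9Ineq349SiteAdjoint`) `Thm31SiteSchemas`;
* ROWS 15–16 display EXACTLY ONE binder `h348 : … Reg335 … U → Conv348Blk (oneCubeOps39YF θ M⋆ 𝔏 bI x) B39 δ39 U` (n06-j gen 14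
  `B9Thm39OneCubeReadingAtLettersY`, the degenerate one-cube reading ON THIS SEAT's FAITHFUL BLOCK MAP `blk39F bI`), and `Conv348Blk` there IS — by `rfl`
  on the one-cube letters — a two-sided inverse of the genuine `L39 = Q′G′²Q′*(U)` with the [4]-(2.51) block majorant `B39(Lʲη)⁻⁴e^{−δ39 d}` w.r.t.
  `blk39F bI`, i.e. the input of this seat's gen-11 `B9Ineq349SiteFromConv348.thm32BlkSchema_of_majorants` (threshold `a39∕c35` for the printed prefix).
Nothing new is estimated: this file is the ≤ 40-line WIRING of landed lemmas to the certificate's CURRENT letter shapes, so that the knit can drop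
`h31S h32B` (row 25 then displays NOTHING of its own; its content is rows 15–16's `h348` and row 18's walk schemas, as in print).

WHAT IS PROVED (sorry-free; no estimate of the paper).
* §1 (rows 15–16 side, any `𝔏 : LettersY N θ M⋆`): `majorants348_of_display348` (the display `h348` under the prefix `c35·M·α₀ ≤ a39`, `0 < c35` ⟹ the
  majorant hypothesis of `thm32BlkSchema_of_majorants` under `M·α₀ ≤ a39∕c35`), ★★ `thm32BlkSchema_of_display348` (= the certificate's `h32B` TYPE at
  `𝔏 := lettersYOfRecordV4 …`, from `h348 + hlev + hβ1`).
* §2 (row 18 side, any normed `𝔸`, any `G`): `majorants342_of_t37_pairM` (Theorem 3.7's leaf on `E37YPairM` + the four site pins ⟹ the two sup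
  majorants under Theorem 3.7's prefix); at `𝔸 = M_N(ℂ)`, `G ≤ U(N)`: ★ `thm31LeftSchema_of_t37_pairM`; at def-Y's v4 record (`G = SU(N)`):
  ★★ `thm31SiteSchemas_lettersYOfRecordV4_of_t37_pairM` (= the certificate's `h31S` TYPE, from `t37 + pins + hlev + hβ1 + hnbr`).
* §3 ★★★ `s349_site_lettersYOfRecordV4_of_t37_display348` — ROW 25 (`B9.Stmt349Printed (d+1) c35 geo9Y bg9Y (x ↦ p349SiteY … (lettersYOfRecordV4 … x))`,
  definitionally the certificate's `s349` type at `opsYNuOfRecordV4E`∕`opsYS349…`) from `t37`, `h348`, the faithful block map (`hlev hβ1`) and the radius-2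
  count `hnbr` ONLY.
KNIT RECIPE (n06-d, next edition; names as in edition 16 MW): drop `h31S h32B`; move the `have s349` below `have t37'` ∕ `t37` and write
`have s349 := s349_site_lettersYOfRecordV4_of_t37_display348 θ.toStage3Params Mstar 𝔯 (trBasis N) hlev hβ1 (hnbr_two_of_le hM₀) 𝔬 rd H hp t37'
hblkS hblkYS hGpS hDS c35Y_pos hB39.le (hr39.trans_le hrδ39) ha39 hM39 h348` (or keep `stmt349Printed_site_of_blockSchemas` and feed it §1∕§2).

HONEST SCOPE.  Bookkeeping over landed lemmas (gen 6 ∕ gen 11 of this seat, n06-j gen 14, n06-k∕n06-d pins); `h348` (Theorem 3.2's (3.48) read on the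
inverse) and row 18's walk-expansion schemas stay the certificate's displayed hypotheses of printed shape; nothing of [B9] or [4] is asserted here;
count-neutral; N06 NOT discharged; one finite 𝕋^{d+1} programme at fixed ε — nothing continuum, nothing OS, nothing about the mass gap.  Cell `pub-ymgap`
(HUMAN RULING D-0062), Track A node N06 [B9], seat `pub-ymgap-dag-n06-i` (gen 15), 2026-08-27; a NEW file, nothing landed is modified; 0 `def`.
-/

noncomputable section

namespace Literature.MathematicalPhysics.QuantumFieldTheory.Balaban1983to89.B9Ineq349SiteFromPinsPairM

open B6RandomWalk (HasMajorant)
open B6RandomWalkHom (HasMajorantHom)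
open B6GlobalChartV1 (blkV1)
open B6Ineq2142KLevelV1 (lvl β)
open B9Thm34Ext (toB6)
open B9Thm37Whole (Ops Conv342)
open B9Cor38Whole (WalkReading)
open B9Thm39WholeBlk (Conv348Blk)
open B9Thm39ReadingAtLetters (X39 L39)
open B9Thm39OneCubeReadingAtLettersY (oneCubeOps39YF)
open B9CoReadingCoordsS (XSK blkSK sIK GcoS DcoS)
open B9Ineq349SiteReading (p349SiteY)
open B9Ineq349SiteFromBlocks (Thm31SiteSchemas Thm32BlkSchema)
open B9Ineq349SiteAdjoint (Thm31LeftSchema thm31SiteSchemas_of_left thm31LeftSchemaSymm_lettersYOfRecordV4)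
open B9Ineq349SiteFromConv342 (majorants_of_thm37Printed thm31LeftSchema_of_majorants stmt349Printed_site_lettersYOfRecordV4_of_majorants)
open B9Ineq349SiteFromConv348 (blk39F thm32BlkSchema_of_majorants)
open B9RWSumsDefinitePins (PinPrims)
open B9RWSumsDefinitePinsPair (PairPrims)
open B9RWSumsDefinitePinsPairM (MixedPrims E37YPairM)
open B7Prop2SpecialUnitary (specialUnitaryUnits specialUnitaryUnits_le_unitaryUnits)
open B9PinMembersKLevelV1 (MemberY geo9Y bg9Y)
open B9RWSumsReadsNbr (nbr)
open Node00

/-! ## §1 Rows 15–16's one display `(3.48)⁻¹` on the faithful one-cube letters ⟹ the (3.48) schema of (3.49) -/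

section Display348

open scoped Matrix.Norms.L2Operator

variable {N : ℕ} (θ : Stage3Params) (Mstar : ℕ) (𝔏 : LettersY N θ Mstar)
variable [∀ x : MemberY θ.d₆ θ.ℓ₆ θ.hd' θ.hL' θ.b₀ θ.b₁ Mstar, Fintype (geo9Y x).Site]
variable (bI : ∀ x : MemberY θ.d₆ θ.ℓ₆ θ.hd' θ.hL' θ.b₀ θ.b₁ Mstar, FBondY x.toKIdx → IBondY x.toKIdx)

/-- **rows 15–16's ONE display, re-thresholded**: `Conv348Blk` of the one-cube letters on the faithful block map IS (`rfl` on `oneCubeOps39YF`) a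
two-sided inverse of `L39 (𝔏 x).parS (𝔏 x).Gp U` with the block majorant `B₁(Lʲη)⁻⁴e^{−δ₁d}` w.r.t. `blk39F (bI x)`; the printed prefix
`c35·M·α₀ ≤ a₁` becomes `M·α₀ ≤ a₁∕c35` (`0 < c35`). [cite: Balaban1985BackgroundPropagators, Thm 3.2 (3.48) p.398 + (3.96) p.411; Balaban1984PropagatorsII, (2.51) p.232] -/
theorem majorants348_of_display348 {c35 : ℝ} (hc : 0 < c35) {B₁ δ₁ a₁ M₁ : ℝ} (hB : 0 ≤ B₁) (hδ : 0 < δ₁) (ha₁ : 0 < a₁) (hM₁ : 0 < M₁)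
    (h348 : ∀ x : MemberY θ.d₆ θ.ℓ₆ θ.hd' θ.hL' θ.b₀ θ.b₁ Mstar, M₁ ≤ (geo9Y x).M → ∀ α₀ : ℝ, 0 < α₀ → c35 * (geo9Y x).M * α₀ ≤ a₁ →
      ∀ U : (bg9Y (Matrix (Fin N) (Fin N) ℂ) (specialUnitaryUnits (Fin N)) x).Cfg,
        (bg9Y (Matrix (Fin N) (Fin N) ℂ) (specialUnitaryUnits (Fin N)) x).Reg335 c35 α₀ U → Conv348Blk (oneCubeOps39YF θ Mstar 𝔏 bI x) B₁ δ₁ U) :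
    ∃ M₂ a₀ B₁ δ₁ : ℝ, 0 < M₂ ∧ 0 < a₀ ∧ 0 ≤ B₁ ∧ 0 < δ₁ ∧
      ∀ x : MemberY θ.d₆ θ.ℓ₆ θ.hd' θ.hL' θ.b₀ θ.b₁ Mstar, M₂ ≤ (geo9Y x).M → ∀ α₀ : ℝ, 0 < α₀ → (geo9Y x).M * α₀ ≤ a₀ →
        ∀ U : (bg9Y (Matrix (Fin N) (Fin N) ℂ) (specialUnitaryUnits (Fin N)) x).Cfg,
          (bg9Y (Matrix (Fin N) (Fin N) ℂ) (specialUnitaryUnits (Fin N)) x).Reg335 c35 α₀ U →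
          ∃ T : Module.End ℝ (X39 (Matrix (Fin N) (Fin N) ℂ) x.toKIdx → ℝ),
            T * L39 x.toKIdx (𝔏 x).parS (𝔏 x).Gp U = 1 ∧ L39 x.toKIdx (𝔏 x).parS (𝔏 x).Gp U * T = 1 ∧
            HasMajorant (g := toB6 (geo9Y x) 0 True) (blk39F (Matrix (Fin N) (Fin N) ℂ) x.toKIdx (bI x)) T
              (fun a a' => B₁ * (geo9Y x).len a ^ (-(4 : ℝ)) * Real.exp (-(δ₁ * (geo9Y x).dist a a'))) := by
  refine ⟨M₁, a₁ / c35, B₁, δ₁, hM₁, div_pos ha₁ hc, hB, hδ, fun x hM α₀ hα₀ hMa U hU => ?_⟩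
  have hMa' : c35 * (geo9Y x).M * α₀ ≤ a₁ := by
    rw [mul_assoc]
    calc c35 * ((geo9Y x).M * α₀) ≤ c35 * (a₁ / c35) := mul_le_mul_of_nonneg_left hMa hc.le
      _ = a₁ := mul_div_cancel₀ a₁ hc.ne'
  obtain ⟨T, hTL, hLT, hm⟩ := h348 x hM α₀ hα₀ hMa' U hU
  exact ⟨T, hTL, hLT, hm⟩

/-- ★★ **THE CERTIFICATE's ROW-25 BINDER `h32B` FROM ROWS 15–16's ONE DISPLAY**: `Thm32BlkSchema (M_N(ℂ)) SU(N) c35 𝔏` (block-complete (3.48) at every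
block pair, constant `max(1, cR39·|κ39|·B₁·e^{2δ₁})`) from `h348` on the faithful one-cube letters and the faithfulness of `bI` (`hlev`, `hβ1`).
[cite: Balaban1985BackgroundPropagators, Thm 3.2 (3.48) p.398 ⇐ Thm 3.9 p.413 + (3.96) p.411; Balaban1984PropagatorsII, (2.51) p.232, (2.45) p.231] -/
theorem thm32BlkSchema_of_display348
    (hlev : ∀ (x : MemberY θ.d₆ θ.ℓ₆ θ.hd' θ.hL' θ.b₀ θ.b₁ Mstar) (f : FBondY x.toKIdx), lvl x.hN x.D x.hk (bI x f) = (blkV1 x.hN x.D f).1.1)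
    (hβ1 : ∀ (x : MemberY θ.d₆ θ.ℓ₆ θ.hd' θ.hL' θ.b₀ θ.b₁ Mstar) (f : FBondY x.toKIdx),
      (B6Geom246MultiLevelTorus.geomT x.D).dist (β x.hN x.D x.hk (bI x f)) (blkV1 x.hN x.D f) ≤ 1)
    {c35 : ℝ} (hc : 0 < c35) {B₁ δ₁ a₁ M₁ : ℝ} (hB : 0 ≤ B₁) (hδ : 0 < δ₁) (ha₁ : 0 < a₁) (hM₁ : 0 < M₁)
    (h348 : ∀ x : MemberY θ.d₆ θ.ℓ₆ θ.hd' θ.hL' θ.b₀ θ.b₁ Mstar, M₁ ≤ (geo9Y x).M → ∀ α₀ : ℝ, 0 < α₀ → c35 * (geo9Y x).M * α₀ ≤ a₁ →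
      ∀ U : (bg9Y (Matrix (Fin N) (Fin N) ℂ) (specialUnitaryUnits (Fin N)) x).Cfg,
        (bg9Y (Matrix (Fin N) (Fin N) ℂ) (specialUnitaryUnits (Fin N)) x).Reg335 c35 α₀ U → Conv348Blk (oneCubeOps39YF θ Mstar 𝔏 bI x) B₁ δ₁ U) :
    Thm32BlkSchema (Matrix (Fin N) (Fin N) ℂ) (specialUnitaryUnits (Fin N)) c35 𝔏 :=
  thm32BlkSchema_of_majorants 𝔏 hlev hβ1 (majorants348_of_display348 θ Mstar 𝔏 bI hc hB hδ ha₁ hM₁ h348)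

end Display348

/-! ## §2 Row 18's Theorem-3.7 leaf on the `PairM` E-letter at the site pins ⟹ the two sup majorants ⟹ the (3.42) schema of (3.49) -/

section PairM

variable {𝔸 : Type} [NormedRing 𝔸] [NormedAlgebra ℂ 𝔸] [CompleteSpace 𝔸] [FiniteDimensional ℝ 𝔸]
variable {κ : Type} [Fintype κ] [DecidableEq κ]
variable {d ℓ : ℕ} {hd : 1 ≤ d + 1} {hL : Odd (ℓ + 1) ∧ 1 < ℓ + 1} {b₀ b₁ : ℝ} {Mstar : ℕ}
variable [∀ x : MemberY d ℓ hd hL b₀ b₁ Mstar, Fintype (geo9Y x).Site] [∀ x : MemberY d ℓ hd hL b₀ b₁ Mstar, DecidableEq (geo9Y x).Site]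

omit [DecidableEq κ] in
/-- **THE TWO SUP MAJORANTS OF THEOREM 3.7 AT THE SITE PINS FROM THE LEAF ON THE `PairM` E-LETTER**: `E37YPairM … (𝔬 x) (rd x) (H x) (K x)` is
`E37AllOfOps …` whose convergence predicate has first conjunct `Conv342 (𝔬 x) 1 (H x) (p.C _) ((1 − 2α)δ₀) U`; with the site pins
`blk = blkY = blkSK (sIK bI)`, `Gp = GcoS … (𝔏 x).Gp`, `D = DcoS` the leaf `B9.Thm37Printed c35 geo9Y bg9Y E` delivers the block majorants
`C(Lʲη)²e^{−δd}` of `GcoS … (𝔏 x).Gp U` and `C·Lʲη·e^{−δd}` of `DcoS ∘ GcoS` under Theorem 3.7's printed prefix.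
[cite: Balaban1985BackgroundPropagators, Thm 3.7 p.409 + «Theorem 3.7 implies (3.42)–(3.47)» p.410] -/
theorem majorants342_of_t37_pairM {G : Subgroup 𝔸ˣ} (b : Module.Basis κ ℝ 𝔸) {c35 : ℝ}
    (𝔏 : ∀ x : MemberY d ℓ hd hL b₀ b₁ Mstar, CovLettersY 𝔸 x) {ι : MemberY d ℓ hd hL b₀ b₁ Mstar → Type}
    (𝔬 : ∀ x : MemberY d ℓ hd hL b₀ b₁ Mstar, Ops (geo9Y x) (bg9Y 𝔸 G x) (XSK κ x.toKIdx) (XSK κ x.toKIdx) (ι x))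
    (rd : ∀ x : MemberY d ℓ hd hL b₀ b₁ Mstar, WalkReading (geo9Y x) (bg9Y 𝔸 G x) (XSK κ x.toKIdx) (ι x))
    (H : MemberY d ℓ hd hL b₀ b₁ Mstar → Prop) {m mN' : ℕ} {Cev NQ : ℝ} {p q : PinPrims} (hp : p.OK) {p3 q3 : PairPrims} {pM qM : MixedPrims}
    {K : ∀ x : MemberY d ℓ hd hL b₀ b₁ Mstar, B9.KernelFamily (geo9Y x) (bg9Y 𝔸 G x)}
    (t37 : B9.Thm37Printed c35 (fun x : MemberY d ℓ hd hL b₀ b₁ Mstar => geo9Y x) (fun x => bg9Y 𝔸 G x)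
      (fun x => E37YPairM (bg := bg9Y 𝔸 G) m mN' Cev NQ p q p3 q3 pM qM (𝔬 x) (rd x) (H x) (K x)))
    {bI : ∀ x : MemberY d ℓ hd hL b₀ b₁ Mstar, FBondY x.toKIdx → IBondY x.toKIdx}
    (hblkS : ∀ x : MemberY d ℓ hd hL b₀ b₁ Mstar, (𝔬 x).blk = blkSK x.toKIdx (sIK x.toKIdx (bI x)))
    (hblkYS : ∀ x : MemberY d ℓ hd hL b₀ b₁ Mstar, (𝔬 x).blkY = blkSK x.toKIdx (sIK x.toKIdx (bI x)))
    (hGpS : ∀ (x : MemberY d ℓ hd hL b₀ b₁ Mstar) (U : (bg9Y 𝔸 G x).Cfg), (𝔬 x).Gp U = GcoS x.toKIdx b (bg9Y 𝔸 G x) (fun U => U) (𝔏 x).Gp U)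
    (hDS : ∀ (x : MemberY d ℓ hd hL b₀ b₁ Mstar) (U : (bg9Y 𝔸 G x).Cfg), (𝔬 x).D U = DcoS x.toKIdx b (bg9Y 𝔸 G x) (fun U => U) U) :
    ∃ M₂ a₀ C δ : ℝ, 0 < M₂ ∧ 0 < a₀ ∧ 0 ≤ C ∧ 0 < δ ∧
      ∀ x : MemberY d ℓ hd hL b₀ b₁ Mstar, M₂ ≤ (geo9Y x).M → ∀ α₀ : ℝ, 0 < α₀ → (geo9Y x).M * α₀ ≤ a₀ →
        ∀ U : (bg9Y 𝔸 G x).Cfg, (bg9Y 𝔸 G x).Reg335 c35 α₀ U →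
          HasMajorant (g := toB6 (geo9Y x) ((fun _ : MemberY d ℓ hd hL b₀ b₁ Mstar => (1 : ℝ)) x) (H x)) (blkSK x.toKIdx (sIK x.toKIdx (bI x)))
              (GcoS x.toKIdx b (bg9Y 𝔸 G x) (fun U => U) (𝔏 x).Gp U)
              (fun a a' => C * (geo9Y x).len a ^ 2 * Real.exp (-(δ * (geo9Y x).dist a a'))) ∧
            HasMajorantHom (g := toB6 (geo9Y x) ((fun _ : MemberY d ℓ hd hL b₀ b₁ Mstar => (1 : ℝ)) x) (H x))
              (blkSK x.toKIdx (sIK x.toKIdx (bI x))) (blkSK x.toKIdx (sIK x.toKIdx (bI x)))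
              (DcoS x.toKIdx b (bg9Y 𝔸 G x) (fun U => U) U ∘ₗ GcoS x.toKIdx b (bg9Y 𝔸 G x) (fun U => U) (𝔏 x).Gp U)
              (fun a a' => C * (geo9Y x).len a * Real.exp (-(δ * (geo9Y x).dist a a'))) :=
  majorants_of_thm37Printed (R := fun _ => (1 : ℝ)) b 𝔏 𝔬 _ t37 (p.C_nonneg hp _) (PinPrims.rate_pos hp)
    (fun _ _ h => h.1) hblkS hblkYS hGpS hDS

open scoped Matrix.Norms.L2Operator

variable {N : ℕ}

/-- ★ **THE LEFT (3.42) SCHEMA OF (3.49) FROM ROW 18's LEAF ON THE `PairM` E-LETTER** (`𝔸 = M_N(ℂ)`, `G ≤ U(N)`, site transporters `G`-valued on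
`G`-valued configurations): `Thm31LeftSchema c35 𝔏`, constant `max(1, mN·C·e^{2δ})`. [cite: Balaban1985BackgroundPropagators, Thm 3.1 (3.42) p.397 ⇐ Thm 3.7 p.410; (3.25) p.394, (3.35) p.396] -/
theorem thm31LeftSchema_of_t37_pairM {G : Subgroup (Matrix (Fin N) (Fin N) ℂ)ˣ} (hG : G ≤ B7Prop2Explicit.unitaryUnits (Matrix (Fin N) (Fin N) ℂ))
    (b : Module.Basis κ ℝ (Matrix (Fin N) (Fin N) ℂ)) {c35 : ℝ} (𝔏 : ∀ x : MemberY d ℓ hd hL b₀ b₁ Mstar, CovLettersY (Matrix (Fin N) (Fin N) ℂ) x)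
    (hparG : ∀ (x : MemberY d ℓ hd hL b₀ b₁ Mstar) (U : CfgY (Matrix (Fin N) (Fin N) ℂ) x.toKIdx), (∀ μ y, U μ y ∈ G) →
      ∀ z w : SiteY x.toKIdx, (𝔏 x).parS U z w ∈ G)
    {bI : ∀ x : MemberY d ℓ hd hL b₀ b₁ Mstar, FBondY x.toKIdx → IBondY x.toKIdx}
    (hlev : ∀ (x : MemberY d ℓ hd hL b₀ b₁ Mstar) (f : FBondY x.toKIdx), lvl x.hN x.D x.hk (bI x f) = (blkV1 x.hN x.D f).1.1)
    (hβ1 : ∀ (x : MemberY d ℓ hd hL b₀ b₁ Mstar) (f : FBondY x.toKIdx), (B6Geom246MultiLevelTorus.geomT x.D).dist (β x.hN x.D x.hk (bI x f)) (blkV1 x.hN x.D f) ≤ 1)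
    {mN : ℕ} (hnbr : ∀ (x : MemberY d ℓ hd hL b₀ b₁ Mstar) (y : (geo9Y x).Site), (nbr (geo9Y x) 2 y).card ≤ mN)
    {ι : MemberY d ℓ hd hL b₀ b₁ Mstar → Type}
    (𝔬 : ∀ x : MemberY d ℓ hd hL b₀ b₁ Mstar, Ops (geo9Y x) (bg9Y (Matrix (Fin N) (Fin N) ℂ) G x) (XSK κ x.toKIdx) (XSK κ x.toKIdx) (ι x))
    (rd : ∀ x : MemberY d ℓ hd hL b₀ b₁ Mstar, WalkReading (geo9Y x) (bg9Y (Matrix (Fin N) (Fin N) ℂ) G x) (XSK κ x.toKIdx) (ι x))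
    (H : MemberY d ℓ hd hL b₀ b₁ Mstar → Prop) {m mN' : ℕ} {Cev NQ : ℝ} {p q : PinPrims} (hp : p.OK) {p3 q3 : PairPrims} {pM qM : MixedPrims}
    {K : ∀ x : MemberY d ℓ hd hL b₀ b₁ Mstar, B9.KernelFamily (geo9Y x) (bg9Y (Matrix (Fin N) (Fin N) ℂ) G x)}
    (t37 : B9.Thm37Printed c35 (fun x : MemberY d ℓ hd hL b₀ b₁ Mstar => geo9Y x) (fun x => bg9Y (Matrix (Fin N) (Fin N) ℂ) G x)
      (fun x => E37YPairM (bg := bg9Y (Matrix (Fin N) (Fin N) ℂ) G) m mN' Cev NQ p q p3 q3 pM qM (𝔬 x) (rd x) (H x) (K x)))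
    (hblkS : ∀ x : MemberY d ℓ hd hL b₀ b₁ Mstar, (𝔬 x).blk = blkSK x.toKIdx (sIK x.toKIdx (bI x)))
    (hblkYS : ∀ x : MemberY d ℓ hd hL b₀ b₁ Mstar, (𝔬 x).blkY = blkSK x.toKIdx (sIK x.toKIdx (bI x)))
    (hGpS : ∀ (x : MemberY d ℓ hd hL b₀ b₁ Mstar) (U : (bg9Y (Matrix (Fin N) (Fin N) ℂ) G x).Cfg),
      (𝔬 x).Gp U = GcoS x.toKIdx b (bg9Y (Matrix (Fin N) (Fin N) ℂ) G x) (fun U => U) (𝔏 x).Gp U)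
    (hDS : ∀ (x : MemberY d ℓ hd hL b₀ b₁ Mstar) (U : (bg9Y (Matrix (Fin N) (Fin N) ℂ) G x).Cfg),
      (𝔬 x).D U = DcoS x.toKIdx b (bg9Y (Matrix (Fin N) (Fin N) ℂ) G x) (fun U => U) U) :
    Thm31LeftSchema (G := G) c35 𝔏 :=
  thm31LeftSchema_of_majorants hG b 𝔏 hparG hlev hβ1 hnbr (majorants342_of_t37_pairM b 𝔏 𝔬 rd H hp t37 hblkS hblkYS hGpS hDS)

/-- ★★ **THE CERTIFICATE's ROW-25 BINDER `h31S` FROM ROW 18's LEAF** at def-Y's v4 record (`G = SU(N)`; the symmetry of `G′(U)` over `parSymY` and the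
adjoint side are theorems, gen 6): `Thm31SiteSchemas (M_N(ℂ)) SU(N) c35 (lettersYOfRecordV4 N θ M⋆ 𝔯)` from `t37` on the `PairM` E-letter, the four site
pins, the faithful block map and the radius-2 count. [cite: Balaban1985BackgroundPropagators, Thm 3.1 (3.42)–(3.47) p.397–398 ⇐ Thm 3.7 p.410; (3.25) p.394, (3.35) p.396] -/
theorem thm31SiteSchemas_lettersYOfRecordV4_of_t37_pairM (θ : Stage3Params) (Mstar : ℕ) (𝔯 : ResY N θ Mstar)
    [∀ x : MemberY θ.d₆ θ.ℓ₆ θ.hd' θ.hL' θ.b₀ θ.b₁ Mstar, Fintype (geo9Y x).Site] [∀ x : MemberY θ.d₆ θ.ℓ₆ θ.hd' θ.hL' θ.b₀ θ.b₁ Mstar, DecidableEq (geo9Y x).Site]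
    (b : Module.Basis κ ℝ (Matrix (Fin N) (Fin N) ℂ)) {c35 : ℝ}
    {bI : ∀ x : MemberY θ.d₆ θ.ℓ₆ θ.hd' θ.hL' θ.b₀ θ.b₁ Mstar, FBondY x.toKIdx → IBondY x.toKIdx}
    (hlev : ∀ (x : MemberY θ.d₆ θ.ℓ₆ θ.hd' θ.hL' θ.b₀ θ.b₁ Mstar) (f : FBondY x.toKIdx), lvl x.hN x.D x.hk (bI x f) = (blkV1 x.hN x.D f).1.1)
    (hβ1 : ∀ (x : MemberY θ.d₆ θ.ℓ₆ θ.hd' θ.hL' θ.b₀ θ.b₁ Mstar) (f : FBondY x.toKIdx),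
      (B6Geom246MultiLevelTorus.geomT x.D).dist (β x.hN x.D x.hk (bI x f)) (blkV1 x.hN x.D f) ≤ 1)
    {mN : ℕ} (hnbr : ∀ (x : MemberY θ.d₆ θ.ℓ₆ θ.hd' θ.hL' θ.b₀ θ.b₁ Mstar) (y : (geo9Y x).Site), (nbr (geo9Y x) 2 y).card ≤ mN)
    {ι : MemberY θ.d₆ θ.ℓ₆ θ.hd' θ.hL' θ.b₀ θ.b₁ Mstar → Type}
    (𝔬 : ∀ x : MemberY θ.d₆ θ.ℓ₆ θ.hd' θ.hL' θ.b₀ θ.b₁ Mstar, Ops (geo9Y x) (bg9Y (Matrix (Fin N) (Fin N) ℂ) (specialUnitaryUnits (Fin N)) x)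
      (XSK κ x.toKIdx) (XSK κ x.toKIdx) (ι x))
    (rd : ∀ x : MemberY θ.d₆ θ.ℓ₆ θ.hd' θ.hL' θ.b₀ θ.b₁ Mstar, WalkReading (geo9Y x) (bg9Y (Matrix (Fin N) (Fin N) ℂ) (specialUnitaryUnits (Fin N)) x)
      (XSK κ x.toKIdx) (ι x))
    (H : MemberY θ.d₆ θ.ℓ₆ θ.hd' θ.hL' θ.b₀ θ.b₁ Mstar → Prop) {m mN' : ℕ} {Cev NQ : ℝ} {p q : PinPrims} (hp : p.OK) {p3 q3 : PairPrims}
    {pM qM : MixedPrims}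
    {K : ∀ x : MemberY θ.d₆ θ.ℓ₆ θ.hd' θ.hL' θ.b₀ θ.b₁ Mstar, B9.KernelFamily (geo9Y x) (bg9Y (Matrix (Fin N) (Fin N) ℂ) (specialUnitaryUnits (Fin N)) x)}
    (t37 : B9.Thm37Printed c35 (fun x : MemberY θ.d₆ θ.ℓ₆ θ.hd' θ.hL' θ.b₀ θ.b₁ Mstar => geo9Y x)
      (fun x => bg9Y (Matrix (Fin N) (Fin N) ℂ) (specialUnitaryUnits (Fin N)) x)
      (fun x => E37YPairM (bg := bg9Y (Matrix (Fin N) (Fin N) ℂ) (specialUnitaryUnits (Fin N))) m mN' Cev NQ p q p3 q3 pM qM (𝔬 x) (rd x) (H x) (K x)))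
    (hblkS : ∀ x : MemberY θ.d₆ θ.ℓ₆ θ.hd' θ.hL' θ.b₀ θ.b₁ Mstar, (𝔬 x).blk = blkSK x.toKIdx (sIK x.toKIdx (bI x)))
    (hblkYS : ∀ x : MemberY θ.d₆ θ.ℓ₆ θ.hd' θ.hL' θ.b₀ θ.b₁ Mstar, (𝔬 x).blkY = blkSK x.toKIdx (sIK x.toKIdx (bI x)))
    (hGpS : ∀ (x : MemberY θ.d₆ θ.ℓ₆ θ.hd' θ.hL' θ.b₀ θ.b₁ Mstar) (U : (bg9Y (Matrix (Fin N) (Fin N) ℂ) (specialUnitaryUnits (Fin N)) x).Cfg),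
      (𝔬 x).Gp U = GcoS x.toKIdx b (bg9Y (Matrix (Fin N) (Fin N) ℂ) (specialUnitaryUnits (Fin N)) x) (fun U => U) (lettersYOfRecordV4 N θ Mstar 𝔯 x).Gp U)
    (hDS : ∀ (x : MemberY θ.d₆ θ.ℓ₆ θ.hd' θ.hL' θ.b₀ θ.b₁ Mstar) (U : (bg9Y (Matrix (Fin N) (Fin N) ℂ) (specialUnitaryUnits (Fin N)) x).Cfg),
      (𝔬 x).D U = DcoS x.toKIdx b (bg9Y (Matrix (Fin N) (Fin N) ℂ) (specialUnitaryUnits (Fin N)) x) (fun U => U) U) :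
    Thm31SiteSchemas (Matrix (Fin N) (Fin N) ℂ) (specialUnitaryUnits (Fin N)) c35 (lettersYOfRecordV4 N θ Mstar 𝔯) :=
  thm31SiteSchemas_of_left specialUnitaryUnits_le_unitaryUnits _
    (thm31LeftSchemaSymm_lettersYOfRecordV4 specialUnitaryUnits_le_unitaryUnits θ Mstar 𝔯
      (thm31LeftSchema_of_t37_pairM specialUnitaryUnits_le_unitaryUnits b (lettersYOfRecordV4 N θ Mstar 𝔯)
        (fun x _ hUG z w => parSymY_mem x.toKIdx hUG z w) hlev hβ1 hnbr 𝔬 rd H hp t37 hblkS hblkYS hGpS hDS))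

end PairM

/-! ## §3 Row 25 at def-Y's v4 record from `t37` and `h348`: NO row-25 binder displayed -/

section Record

open scoped Matrix.Norms.L2Operator

variable {N : ℕ} {κ : Type} [Fintype κ] [DecidableEq κ]

/-- ★★★ **ROW 25 OF THE N06 CERTIFICATE FROM WHAT IT ALREADY HOLDS**: (3.49) for the genuine `P = I − R(U)` at def-Y's v4 record —
`B9.Stmt349Printed (d+1) c35 geo9Y bg9Y (x ↦ p349SiteY … (lettersYOfRecordV4 N θ M⋆ 𝔯 x))` (definitionally the certificate's `s349`) — from ROW 18's
leaf `t37` on the `PairM` E-letter at the four site pins, ROWS 15–16's one display `h348` (`(3.48)⁻¹` on the faithful one-cube letters), the faithful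
block map (`hlev`, `hβ1`) and the radius-2 count (`hnbr`); the displayed `h31S h32B` of edition 16 are no longer inputs.
[cite: Balaban1985BackgroundPropagators, (3.49) p.399 («using again Lemma 2.1»); Thm 3.1 ⇐ Thm 3.7 p.410; Thm 3.2 ⇐ Thm 3.9 p.413 + (3.96) p.411; (3.25) p.394; Balaban1984PropagatorsII, Lemma 2.1 p.234, (2.51) p.232] -/
theorem s349_site_lettersYOfRecordV4_of_t37_display348 (θ : Stage3Params) (Mstar : ℕ) (𝔯 : ResY N θ Mstar)
    [∀ x : MemberY θ.d₆ θ.ℓ₆ θ.hd' θ.hL' θ.b₀ θ.b₁ Mstar, Fintype (geo9Y x).Site] [∀ x : MemberY θ.d₆ θ.ℓ₆ θ.hd' θ.hL' θ.b₀ θ.b₁ Mstar, DecidableEq (geo9Y x).Site]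
    (b : Module.Basis κ ℝ (Matrix (Fin N) (Fin N) ℂ)) {c35 : ℝ}
    {bI : ∀ x : MemberY θ.d₆ θ.ℓ₆ θ.hd' θ.hL' θ.b₀ θ.b₁ Mstar, FBondY x.toKIdx → IBondY x.toKIdx}
    (hlev : ∀ (x : MemberY θ.d₆ θ.ℓ₆ θ.hd' θ.hL' θ.b₀ θ.b₁ Mstar) (f : FBondY x.toKIdx), lvl x.hN x.D x.hk (bI x f) = (blkV1 x.hN x.D f).1.1)
    (hβ1 : ∀ (x : MemberY θ.d₆ θ.ℓ₆ θ.hd' θ.hL' θ.b₀ θ.b₁ Mstar) (f : FBondY x.toKIdx),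
      (B6Geom246MultiLevelTorus.geomT x.D).dist (β x.hN x.D x.hk (bI x f)) (blkV1 x.hN x.D f) ≤ 1)
    {mN : ℕ} (hnbr : ∀ (x : MemberY θ.d₆ θ.ℓ₆ θ.hd' θ.hL' θ.b₀ θ.b₁ Mstar) (y : (geo9Y x).Site), (nbr (geo9Y x) 2 y).card ≤ mN)
    -- row 18: Theorem 3.7's leaf on the `PairM` E-letter at the site pins
    {ι : MemberY θ.d₆ θ.ℓ₆ θ.hd' θ.hL' θ.b₀ θ.b₁ Mstar → Type}
    (𝔬 : ∀ x : MemberY θ.d₆ θ.ℓ₆ θ.hd' θ.hL' θ.b₀ θ.b₁ Mstar, Ops (geo9Y x) (bg9Y (Matrix (Fin N) (Fin N) ℂ) (specialUnitaryUnits (Fin N)) x)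
      (XSK κ x.toKIdx) (XSK κ x.toKIdx) (ι x))
    (rd : ∀ x : MemberY θ.d₆ θ.ℓ₆ θ.hd' θ.hL' θ.b₀ θ.b₁ Mstar, WalkReading (geo9Y x) (bg9Y (Matrix (Fin N) (Fin N) ℂ) (specialUnitaryUnits (Fin N)) x)
      (XSK κ x.toKIdx) (ι x))
    (H : MemberY θ.d₆ θ.ℓ₆ θ.hd' θ.hL' θ.b₀ θ.b₁ Mstar → Prop) {m mN' : ℕ} {Cev NQ : ℝ} {p q : PinPrims} (hp : p.OK) {p3 q3 : PairPrims}
    {pM qM : MixedPrims}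
    {K : ∀ x : MemberY θ.d₆ θ.ℓ₆ θ.hd' θ.hL' θ.b₀ θ.b₁ Mstar, B9.KernelFamily (geo9Y x) (bg9Y (Matrix (Fin N) (Fin N) ℂ) (specialUnitaryUnits (Fin N)) x)}
    (t37 : B9.Thm37Printed c35 (fun x : MemberY θ.d₆ θ.ℓ₆ θ.hd' θ.hL' θ.b₀ θ.b₁ Mstar => geo9Y x)
      (fun x => bg9Y (Matrix (Fin N) (Fin N) ℂ) (specialUnitaryUnits (Fin N)) x)
      (fun x => E37YPairM (bg := bg9Y (Matrix (Fin N) (Fin N) ℂ) (specialUnitaryUnits (Fin N))) m mN' Cev NQ p q p3 q3 pM qM (𝔬 x) (rd x) (H x) (K x)))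
    (hblkS : ∀ x : MemberY θ.d₆ θ.ℓ₆ θ.hd' θ.hL' θ.b₀ θ.b₁ Mstar, (𝔬 x).blk = blkSK x.toKIdx (sIK x.toKIdx (bI x)))
    (hblkYS : ∀ x : MemberY θ.d₆ θ.ℓ₆ θ.hd' θ.hL' θ.b₀ θ.b₁ Mstar, (𝔬 x).blkY = blkSK x.toKIdx (sIK x.toKIdx (bI x)))
    (hGpS : ∀ (x : MemberY θ.d₆ θ.ℓ₆ θ.hd' θ.hL' θ.b₀ θ.b₁ Mstar) (U : (bg9Y (Matrix (Fin N) (Fin N) ℂ) (specialUnitaryUnits (Fin N)) x).Cfg),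
      (𝔬 x).Gp U = GcoS x.toKIdx b (bg9Y (Matrix (Fin N) (Fin N) ℂ) (specialUnitaryUnits (Fin N)) x) (fun U => U) (lettersYOfRecordV4 N θ Mstar 𝔯 x).Gp U)
    (hDS : ∀ (x : MemberY θ.d₆ θ.ℓ₆ θ.hd' θ.hL' θ.b₀ θ.b₁ Mstar) (U : (bg9Y (Matrix (Fin N) (Fin N) ℂ) (specialUnitaryUnits (Fin N)) x).Cfg),
      (𝔬 x).D U = DcoS x.toKIdx b (bg9Y (Matrix (Fin N) (Fin N) ℂ) (specialUnitaryUnits (Fin N)) x) (fun U => U) U)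
    -- rows 15–16: the one display `(3.48)⁻¹` on the faithful one-cube letters
    (hc : 0 < c35) {B₁ δ₁ a₁ M₁ : ℝ} (hB : 0 ≤ B₁) (hδ : 0 < δ₁) (ha₁ : 0 < a₁) (hM₁ : 0 < M₁)
    (h348 : ∀ x : MemberY θ.d₆ θ.ℓ₆ θ.hd' θ.hL' θ.b₀ θ.b₁ Mstar, M₁ ≤ (geo9Y x).M → ∀ α₀ : ℝ, 0 < α₀ → c35 * (geo9Y x).M * α₀ ≤ a₁ →
      ∀ U : (bg9Y (Matrix (Fin N) (Fin N) ℂ) (specialUnitaryUnits (Fin N)) x).Cfg,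
        (bg9Y (Matrix (Fin N) (Fin N) ℂ) (specialUnitaryUnits (Fin N)) x).Reg335 c35 α₀ U →
          Conv348Blk (oneCubeOps39YF θ Mstar (lettersYOfRecordV4 N θ Mstar 𝔯) bI x) B₁ δ₁ U) :
    B9.Stmt349Printed (θ.d₆ + 1) c35 (geo9Y (d := θ.d₆) (ℓ := θ.ℓ₆) (hd := θ.hd') (hL := θ.hL') (b₀ := θ.b₀) (b₁ := θ.b₁) (Mstar := Mstar))
      (bg9Y (Matrix (Fin N) (Fin N) ℂ) (specialUnitaryUnits (Fin N))) (fun x => p349SiteY (Matrix (Fin N) (Fin N) ℂ) (specialUnitaryUnits (Fin N)) x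
        (lettersYOfRecordV4 N θ Mstar 𝔯 x)) :=
  stmt349Printed_site_lettersYOfRecordV4_of_majorants θ Mstar 𝔯 b hlev hβ1 hnbr
    (majorants342_of_t37_pairM b (lettersYOfRecordV4 N θ Mstar 𝔯) 𝔬 rd H hp t37 hblkS hblkYS hGpS hDS)
    (thm32BlkSchema_of_display348 θ Mstar (lettersYOfRecordV4 N θ Mstar 𝔯) bI hlev hβ1 hc hB hδ ha₁ hM₁ h348)

end Record

end Literature.MathematicalPhysics.QuantumFieldTheory.Balaban1983to89.B9Ineq349SiteFromPinsPairM

end
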